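import Mathlib
import Literature.NumberTheory.LFunctions.Zhang2022.Section4Statements
import Literature.NumberTheory.LFunctions.Zhang2022.SkeletonAssembly
import Literature.NumberTheory.LFunctions.Zhang2022.Section4TildeZ
import HarnessLib

/-!
# Zhang (2022), §4 Lemma 4.4 (proof): the functional equation on the line `Re w = −σ − 1/2`
# (DAG `Z22:§4.u029`) DISCHARGED

Topic `Literature/NumberTheory/LFunctions/Zhang2022` (Landau–Siegel audit tree; verdict-neutral).
Y. Zhang, *Discrete mean estimates and the Landau–Siegel zero*, arXiv:2211.02515v1 (2022)
[Zhang2022LandauSiegel] — **an unrefereed manuscript under adjudication.** In the proof of Lemma 4.4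
[Z22 p.19, tex L1066–L1070]:

> On the other hand, by the functional equation, for `u = −σ − 1/2`,
> `L(s+w,ψ)L(s+w,ψχ) = Z̃(s+w,ψ) Σₙ ν(n)ψ̄(n) n^{−(1−s−w)}`.

typed (L1-t3) as `Section4.FELine`. This file PROVES it outright (`feLine_holds`), for every
`ψ ∈ Ψ`, `s ∈ Ω₃` and every `w` with `Re w = −σ − 1/2` — including the one point of that line with
`Im(s+w) = 0`, where the tree's functional equation `GammaFactor.LFunction_mul_LFunction_eq`
(stated for `Im ≠ 0`) is replaced by the same computation with the non-vanishing of the archimedean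
factors checked directly (`Γ_ℝ(z) ≠ 0` unless `z ∈ −2ℕ`; here `Re(s+w) = −1/2`, `Re(1−s−w) = 3/2`):

* `gammaFactor_ne_zero_of_re_notint` — `γ(θ,z) ≠ 0` whenever `Re z ∉ ℤ`;
* `LFunction_eq_Zfac_mul_of_ne` — (2.2) `L(z,θ) = Z(z,θ)L(1−z,θ̄)` for primitive `θ` mod `k ≠ 1`
  under the two non-vanishing hypotheses (the tree's proof, verbatim otherwise);
* `psiChi_apply_natCast` — `(ψχ)(n) = χ(n)ψ(n)` on `ℕ` (the character `ψχ (mod Dp)` of §4 p. 8);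
* `LSeries_nu_psiBar_eq` — `L(z,ψ̄)L(z,(ψχ)‾) = Σₙ ν(n)ψ̄(n)n^{−z}` for `Re z > 1`
  (`ψ̄ ∗ χψ̄ = νψ̄`, Mathlib's `LSeries_convolution'`);
* `feLine_holds : FELine`.

Nothing about Theorems 1–2 of the source or about Landau–Siegel zeros is stated or implied.

## References

* Y. Zhang, arXiv:2211.02515v1 (2022), §4 p. 19 (proof of Lemma 4.4), §2 (2.2), §4 (4.4).
  [cite: Zhang2022LandauSiegel, §4 Lemma 4.4 (proof)]
-/

noncomputable section

open Complex Real ComplexConjugate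
open scoped LSeries.notation

namespace Literature.NumberTheory.LFunctions.Zhang2022.Section4

open Skeleton

/-! ## The archimedean factors do not vanish off `Re z ∈ ℤ` -/

/-- `Γ_ℝ(z) ≠ 0` when `Re z` is not an integer (its zeros are `z ∈ −2ℕ`). [folklore] -/
private theorem Gammaℝ_ne_zero_of_re_notint {z : ℂ} (hz : ∀ m : ℤ, z.re ≠ m) : Gammaℝ z ≠ 0 := by
  rw [Ne, Gammaℝ_eq_zero_iff, not_exists]
  intro n hn
  apply hz (-(2 * n))
  rw [hn]
  simp

/-- `γ(θ,z) ≠ 0` (Mathlib's `DirichletCharacter.gammaFactor`: `Γ_ℝ(z)` or `Γ_ℝ(z+1)`) when `Re z`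
is not an integer. [folklore] -/
private theorem gammaFactor_ne_zero_of_re_notint {k : ℕ} (θ : DirichletCharacter ℂ k) {z : ℂ}
    (hz : ∀ m : ℤ, z.re ≠ m) : DirichletCharacter.gammaFactor θ z ≠ 0 := by
  unfold DirichletCharacter.gammaFactor
  split_ifs
  · exact Gammaℝ_ne_zero_of_re_notint hz
  · refine Gammaℝ_ne_zero_of_re_notint fun m hm => hz (m - 1) ?_
    rw [Complex.add_re, Complex.one_re] at hm
    push_cast
    linarith

/-! ## The functional equation (2.2) under explicit non-vanishing hypotheses -/

/-- **(2.2) `L(z,θ) = Z(z,θ)L(1−z,θ̄)`** for primitive `θ` mod `k ≠ 1`, assuming only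
`γ(θ,z) ≠ 0` and `γ(θ̄,1−z) ≠ 0` (the tree's `GammaFactor.LFunction_eq_Zfac_mul` assumes
`Im z ≠ 0`; same computation). [cite: Zhang2022LandauSiegel, §2 (2.2)] -/
theorem LFunction_eq_Zfac_mul_of_ne {k : ℕ} [NeZero k] {θ : DirichletCharacter ℂ k}
    (hθ : θ.IsPrimitive) (hk : k ≠ 1) {s : ℂ}
    (hγ1 : DirichletCharacter.gammaFactor θ s ≠ 0)
    (hγ2 : DirichletCharacter.gammaFactor θ⁻¹ (1 - s) ≠ 0) :
    θ.LFunction s = GammaFactor.Zfac θ s * θ⁻¹.LFunction (1 - s) := by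
  classical
  have hk0 : (k : ℂ) ≠ 0 := Nat.cast_ne_zero.mpr (NeZero.ne k)
  have h1 := DirichletCharacter.LFunction_eq_completed_div_gammaFactor θ s (Or.inr hk)
  have h2 := DirichletCharacter.IsPrimitive.completedLFunction_one_sub hθ (1 - s)
  rw [sub_sub_cancel] at h2
  have h3 := DirichletCharacter.LFunction_eq_completed_div_gammaFactor θ⁻¹ (1 - s) (Or.inr hk)
  have h3' : DirichletCharacter.completedLFunction θ⁻¹ (1 - s)
      = θ⁻¹.LFunction (1 - s) * DirichletCharacter.gammaFactor θ⁻¹ (1 - s) := by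
    rw [h3, div_mul_cancel₀ _ hγ2]
  have hρ : (k : ℂ) ^ ((1 : ℂ) - s - 1 / 2) * DirichletCharacter.rootNumber θ
      = (if θ.Even then 1 else -I) * GammaFactor.tau θ * (k : ℂ) ^ (-s) := by
    unfold DirichletCharacter.rootNumber
    have hkpow : (k : ℂ) ^ ((1 : ℂ) - s - 1 / 2) = (k : ℂ) ^ (-s) * (k : ℂ) ^ ((1 : ℂ) / 2) := by
      rw [← cpow_add _ _ hk0]; congr 1; ring
    have hkh : (k : ℂ) ^ ((1 : ℂ) / 2) ≠ 0 := by
      rw [Ne, cpow_eq_zero_iff, not_and_or]; exact Or.inl hk0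
    rw [hkpow, GammaFactor.tau]
    split_ifs with he
    · rw [pow_zero, div_one]
      field_simp
    · rw [pow_one]
      field_simp
      rw [I_sq]
      ring
  calc θ.LFunction s
      = DirichletCharacter.completedLFunction θ s / DirichletCharacter.gammaFactor θ s := h1
    _ = ((k : ℂ) ^ ((1 : ℂ) - s - 1 / 2) * DirichletCharacter.rootNumber θ)
          * (DirichletCharacter.gammaFactor θ⁻¹ (1 - s) / DirichletCharacter.gammaFactor θ s)
          * θ⁻¹.LFunction (1 - s) := by
        rw [h2, h3']
        field_simp
    _ = GammaFactor.Zfac θ s * θ⁻¹.LFunction (1 - s) := by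
        rw [hρ, GammaFactor.Zfac_eq_gammaFactor_div]

/-- **(4.4) on the line `Re z = −1/2`**: `L(z,ψ)L(z,θ₂) = Z̃(z)·L(1−z,ψ̄)L(1−z,θ̄₂)` for primitive
`ψ` mod `k₁ ≠ 1`, `θ₂` mod `k₂ ≠ 1` and ANY `z` with `Re z = −1/2` (no condition on `Im z`).
[cite: Zhang2022LandauSiegel, §4 (4.4)] -/
theorem LFunction_mul_LFunction_eq_of_re {k₁ k₂ : ℕ} [NeZero k₁] [NeZero k₂]
    {ψ : DirichletCharacter ℂ k₁} {θ₂ : DirichletCharacter ℂ k₂}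
    (hψ : ψ.IsPrimitive) (hk₁ : k₁ ≠ 1) (hθ : θ₂.IsPrimitive) (hk₂ : k₂ ≠ 1) {z : ℂ}
    (hz : z.re = -1 / 2) :
    ψ.LFunction z * θ₂.LFunction z
      = GammaFactor.tildeZ ψ θ₂ z * (ψ⁻¹.LFunction (1 - z) * θ₂⁻¹.LFunction (1 - z)) := by
  have hz' : ∀ m : ℤ, z.re ≠ m := by
    intro m hm
    rw [hz] at hm
    have h2 : (2 : ℝ) * m = -1 := by linarith
    have h2' : (2 * m : ℤ) = -1 := by exact_mod_cast h2
    omega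
  have h1z : ∀ m : ℤ, (1 - z).re ≠ m := by
    intro m hm
    rw [Complex.sub_re, Complex.one_re, hz] at hm
    have h2 : (2 : ℝ) * m = 3 := by linarith
    have h2' : (2 * m : ℤ) = 3 := by exact_mod_cast h2
    omega
  rw [LFunction_eq_Zfac_mul_of_ne hψ hk₁ (gammaFactor_ne_zero_of_re_notint ψ hz')
      (gammaFactor_ne_zero_of_re_notint ψ⁻¹ h1z),
    LFunction_eq_Zfac_mul_of_ne hθ hk₂ (gammaFactor_ne_zero_of_re_notint θ₂ hz')
      (gammaFactor_ne_zero_of_re_notint θ₂⁻¹ h1z), GammaFactor.tildeZ_def]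
  ring

/-! ## The character `ψχ (mod Dp)` on `ℕ`, and `ψ̄ ∗ (ψχ)‾ = νψ̄` -/

section WithCharacter

variable {D : ℕ} (χ : DirichletCharacter ℂ D) (x : Chr D)

/-- **`(ψχ)(n) = χ(n)ψ(n)`** for every natural `n` (the product character to the modulus `Dp`,
§4 p. 8: both sides vanish unless `(n, Dp) = 1`). [cite: Zhang2022LandauSiegel, §4 p. 8] -/
theorem psiChi_apply_natCast (n : ℕ) :
    psiChi χ x (n : ZMod (D * x.p)) = χ (n : ZMod D) * x.ψ (n : ZMod x.p) := by
  by_cases hn : n.Coprime (D * x.p)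
  · have hnZ : IsCoprime (n : ℤ) ((D * x.p : ℕ) : ℤ) := by
      rw [Int.isCoprime_iff_gcd_eq_one, Int.gcd_natCast_natCast]; exact hn
    have h1 := DirichletCharacter.changeLevel_eq_cast_of_dvd' χ (dvd_mul_right D x.p) hnZ
    have h2 := DirichletCharacter.changeLevel_eq_cast_of_dvd' x.ψ (dvd_mul_left x.p D) hnZ
    simp only [Int.cast_natCast] at h1 h2
    rw [psiChi, MulChar.mul_apply, h1, h2]
  · have hnu : ¬ IsUnit (n : ZMod (D * x.p)) := by rwa [ZMod.isUnit_iff_coprime]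
    rw [MulChar.map_nonunit _ hnu]
    rcases (not_and_or.mp fun h => hn (Nat.Coprime.mul_right h.1 h.2)) with h | h
    · rw [MulChar.map_nonunit χ (show ¬ IsUnit (n : ZMod D) by rwa [ZMod.isUnit_iff_coprime]),
        zero_mul]
    · rw [MulChar.map_nonunit x.ψ
        (show ¬ IsUnit (n : ZMod x.p) by rwa [ZMod.isUnit_iff_coprime]), mul_zero]

/-- For a Dirichlet character `θ` with values in `ℂ`: `θ⁻¹(a) = conj(θ(a))` (both vanish at
non-units; `|θ(a)| = 1` at units). [folklore] -/
private theorem inv_apply_eq_conj {k : ℕ} [NeZero k] (θ : DirichletCharacter ℂ k) (a : ZMod k) :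
    θ⁻¹ a = conj (θ a) := by
  rw [MulChar.inv_apply_eq_inv']
  by_cases ha : IsUnit a
  · obtain ⟨u, rfl⟩ := ha
    exact Complex.inv_eq_conj (θ.unit_norm_eq_one u)
  · rw [MulChar.map_nonunit _ ha, inv_zero, map_zero]

/-- A real (quadratic) character is its own inverse on every argument: `χ⁻¹(a) = χ(a)`.
[folklore] -/
private theorem inv_apply_of_isQuadratic {χ : DirichletCharacter ℂ D} (hq : χ.IsQuadratic) (a : ZMod D) :
    χ⁻¹ a = χ a := by
  rw [hq.inv]

/-- **`(ψχ)‾(n) = χ(n)ψ̄(n)`** on `ℕ` for real `χ`. [cite: Zhang2022LandauSiegel, §4 p. 19] -/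
theorem psiChi_inv_apply_natCast (hq : χ.IsQuadratic) (n : ℕ) :
    (psiChi χ x)⁻¹ (n : ZMod (D * x.p)) = χ (n : ZMod D) * psiBarFn x n := by
  rw [MulChar.inv_apply_eq_inv', psiChi_apply_natCast, mul_inv, ← MulChar.inv_apply_eq_inv',
    ← MulChar.inv_apply_eq_inv', inv_apply_of_isQuadratic hq, inv_apply_eq_conj, psiBarFn]

/-- **`ψ̄ ∗ (ψχ)‾ = νψ̄`**: the Dirichlet convolution of `n ↦ ψ̄(n)` and `n ↦ (ψχ)‾(n)` is
`n ↦ ν(n)ψ̄(n)`, `ν(n) = Σ_{d∣n} χ(d)` (for real `χ`; `n ≥ 1`).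
[cite: Zhang2022LandauSiegel, §4 p. 19] -/
theorem convolution_psiBar_psiChiBar (hq : χ.IsQuadratic) (n : ℕ) :
    ((fun m : ℕ => (x.ψ)⁻¹ (m : ZMod x.p)) ⍟ (fun m : ℕ => (psiChi χ x)⁻¹ (m : ZMod (D * x.p)))) n
      = nu χ n * psiBarFn x n := by
  rw [LSeries.convolution_def]
  simp only [psiChi_inv_apply_natCast χ x hq, inv_apply_eq_conj]
  have key : ∀ p ∈ n.divisorsAntidiagonal,
      conj (x.ψ (p.1 : ZMod x.p)) * (χ (p.2 : ZMod D) * psiBarFn x p.2)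
        = χ (p.2 : ZMod D) * psiBarFn x n := by
    intro p hp
    have h := (Nat.mem_divisorsAntidiagonal.mp hp).1
    rw [psiBarFn, psiBarFn, ← h, Nat.cast_mul, map_mul, map_mul]
    ring
  rw [Finset.sum_congr rfl key, ← Finset.sum_mul]
  congr 1
  rw [nu, Literature.NumberTheory.LFunctions.divisorSumChar_apply]
  exact Nat.sum_divisorsAntidiagonal' (f := fun _ b => χ (b : ZMod D))

/-- **`L(z,ψ̄)L(z,(ψχ)‾) = Σₙ ν(n)ψ̄(n)n^{−z}`** for `Re z > 1` (product of the two Dirichlet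
series = Dirichlet series of the convolution `νψ̄`). [cite: Zhang2022LandauSiegel, §4 p. 19] -/
theorem LFunction_inv_mul_eq_LSeries [NeZero D] (hq : χ.IsQuadratic) {z : ℂ} (hz : 1 < z.re) :
    (x.ψ)⁻¹.LFunction z * (psiChi χ x)⁻¹.LFunction z
      = LSeries (fun n => nu χ n * psiBarFn x n) z := by
  rw [DirichletCharacter.LFunction_eq_LSeries _ hz, DirichletCharacter.LFunction_eq_LSeries _ hz,
    ← LSeries_convolution' (DirichletCharacter.LSeriesSummable_of_one_lt_re _ hz)
      (DirichletCharacter.LSeriesSummable_of_one_lt_re _ hz)]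
  exact LSeries_congr (fun {n} _ => convolution_psiBar_psiChiBar χ x hq n) z

end WithCharacter

/-! ## `Z22:§4.u029` -/

/-- `⌈e³⌉ ≤ D` gives `3 ≤ D`. [folklore] -/
private theorem three_le_of_ceil_exp_le {D : ℕ} (hD : ⌈Real.exp 3⌉₊ ≤ D) : 3 ≤ D := by
  have h : Real.exp 3 ≤ D := le_trans (Nat.le_ceil _) (by exact_mod_cast hD)
  have h3 : (3 : ℝ) ≤ D := by linarith [Real.add_one_le_exp (3 : ℝ)]
  exact_mod_cast h3

/-- **`Z22:§4.u029` HOLDS** (threshold `D ≥ ⌈e³⌉`, every `ψ ∈ Ψ`, `s ∈ Ω₃`, every `w` with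
`Re w = −σ − 1/2`): "by the functional equation, for `u = −σ − 1/2`,
`L(s+w,ψ)L(s+w,ψχ) = Z̃(s+w,ψ)Σₙ ν(n)ψ̄(n)n^{−(1−s−w)}`" — (4.4) at `z = s + w` (`Re z = −1/2`,
where no archimedean factor vanishes, so no condition on `Im z` is needed) and
`L(1−z,ψ̄)L(1−z,(ψχ)‾) = Σ ν(n)ψ̄(n)n^{−(1−z)}` (`Re(1−z) = 3/2 > 1`).
[cite: Zhang2022LandauSiegel, §4 Lemma 4.4 (proof) p. 19] -/
theorem feLine_holds : FELine := by
  refine ⟨⌈Real.exp 3⌉₊, fun D _ χ hD hq hp x s _ w hw => ?_⟩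
  have hD3 : 3 ≤ D := three_le_of_ceil_exp_le hD
  have hprim : (psiChi χ x).IsPrimitive := psiChiPrimitive_holds D χ x hD3 hp
  have hDp : D * x.p ≠ 1 := by
    have := x.p_ne_one
    intro h
    exact this (Nat.eq_one_of_mul_eq_one_left h)
  have hz : (s + w).re = -1 / 2 := by rw [Complex.add_re, hw]; ring
  have h1z : 1 < (1 - (s + w)).re := by
    rw [Complex.sub_re, Complex.one_re, hz]; norm_num
  rw [LL, tildeZW, LFunction_mul_LFunction_eq_of_re x.prim x.p_ne_one hprim hDp hz,
    LFunction_inv_mul_eq_LSeries χ x hq h1z, sub_add_eq_sub_sub]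


end Literature.NumberTheory.LFunctions.Zhang2022.Section4

/-! ## `_holds` aliases (appended 2026-08-28)

The named fact(s) below are already theorems of the tree under a differently-cased `_holds` name; the exact-name `_holds`
alias records the discharge under the tree's naming convention (D-0026 bookkeeping: proof term =
the existing theorem, no statement or definition edited). -/

/-- `FELine` is a theorem of the tree (`Literature.NumberTheory.LFunctions.Zhang2022.Section4.feLine_holds`). [cite: Zhang2022LandauSiegel, §4 Lemma 4.4 (proof) p. 19] -/
theorem _root_.Literature.NumberTheory.LFunctions.Zhang2022.Section4.FELine_holds : _root_.Literature.NumberTheory.LFunctions.Zhang2022.Section4.FELine :=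
  _root_.Literature.NumberTheory.LFunctions.Zhang2022.Section4.feLine_holds
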